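import Summits.QuantumFields.YangMills.Theses.RandomConstraintAnnealing
import Summits.QuantumFields.YangMills.Theses.EquipartitionCriticality
import Summits.QuantumFields.YangMills.Theorems.EquipartitionCriticalityFreeEnergyLogCoefficient
import Summits.QuantumFields.YangMills.Theorems.EquipartitionCriticalityEquipartitionPinsProbe
import Summits.QuantumFields.YangMills.Theorems.EquipartitionCriticalityRPProbeCriticality
import HarnessLib

/-!
# `LatticeGapToClay` (crux `stmt-QuantumFields-8718`, route `RandomConstraintAnnealing`) — the hub split

Route `RandomConstraintAnnealing` of `QuantumFields/YangMills`, deciding crux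
`Summit.QuantumFields.YangMills.Theses.RandomConstraintAnnealing.LatticeGapToClay :=
TubeGapLatticeLeg → YangMills` (the UV / Osterwalder–Schrader legs given the weak-coupling,
volume-uniform lattice gap).  This file records the crux-strategist's TYPED DECOMPOSITION (BC2
redirect, human ruling 2026-08-16) of that crux into two pieces and proves the assembly:

* piece 1, `WeakCouplingCriticality` — **criticality at weak coupling** (Chatterjee's Problem 5.1(b),
  all-observable torus form): for every compact simple `G`, every faithful unitary lattice
  representation `r`, every threshold `β₁` and every rate function `m`, IF `m(β) > 0` is an admissible
  volume-uniform exponential clustering rate of all pairs of gauge-invariant local observables on the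
  odd tori at every `β ≥ β₁`, THEN `m(β) → 0⁺` in the sense `∀ m₀ > 0, ∀ᶠ β, m β < m₀` (the lattice
  correlation length diverges as `β → ∞`).  This piece is a THEOREM of the tree: it is the composite of
  the three closed items of route `EquipartitionCriticality` — `freeEnergyLogCoefficient_proof`
  (Chatterjee's free-energy theorem for simple `G`), `EquipartitionPinsProbe_proof` (the local free-gluon
  law pins the β-rescaled plaquette probe) and `rpProbeCriticality_proof` (reflection positivity turns the
  probe limit into criticality) — proved here as `weakCouplingCriticality`.
* piece 2, the HUB `EquipartitionCriticality.CriticalContinuumLimit` (item `stmt-QuantumFields-15940`,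
  = `DirichletWindow.WeakCouplingContinuumLimit`, open, with its own registered three-stub birth
  skeleton `Cruxes/WeakCouplingContinuumLimit/Lines/birth.lean`): gap-at-large-β (hyp 1) plus
  criticality (hyp 2) give the `G`-clause of `YangMills`.

Assembly `latticeGapToClay_of_subs : WeakCouplingCriticality-body → CriticalContinuumLimit →
LatticeGapToClay` is pure logic: `TubeGapLatticeLeg` supplies hyp (1) of the hub for each `G` (its body
is `LatticeGapLargeBeta`'s up to the grouping of the binders `∀ S, S₀ β ≤ S → ∀ n, n ≤ S` versus
`∀ S n, S₀ β ≤ S → n ≤ S`), piece 1 supplies hyp (2).  Corollary `latticeGapToClay_of_hub`: the hub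
alone implies the crux (the Wiles/Ribet shape of the split: the proved piece is Chatterjee 5.1(b), the
open piece is the shared hub).  No Literature fact is consumed beyond those already in the cone of the
three landed `EquipartitionCriticality` theorems.

References: S. Chatterjee, arXiv:1803.01950, Problems 5.1(a)(b) and arXiv:1602.01222 Thm. 2.1;
A. Jaffe, E. Witten, *Quantum Yang–Mills theory* (2000) §4–§6; K. Osterwalder, E. Seiler,
Ann. Phys. 110 (1978) §§2–4.
-/

noncomputable section

namespace Summit.QuantumFields.YangMills.Theorems

open Filter
open Literature.MathematicalPhysics.QuantumFieldTheory
open Summit.QuantumFields.YangMills.Theses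

/-- **Weak-coupling criticality of 4-D lattice Yang–Mills for every compact simple gauge group**
(Chatterjee's Problem 5.1(b), all-observable odd-torus form = hypothesis (2) of the hub
`EquipartitionCriticality.CriticalContinuumLimit`): every admissible volume-uniform exponential
clustering rate `m(β)` of Wilson's lattice theory in a faithful representation `r` tends to `0` as
`β → ∞`.  Proof: the chain of the three landed theorems of route `EquipartitionCriticality`
(`freeEnergyLogCoefficient_proof` → `EquipartitionPinsProbe_proof` → `rpProbeCriticality_proof`).
[cite: arXiv180301950, Problem 5.1(b)] [cite: arXiv160201222, Thm. 2.1] -/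
theorem weakCouplingCriticality :
    ∀ (G : Type) [Group G] [TopologicalSpace G] [IsTopologicalGroup G] [CompactSpace G],
      IsCompactSimpleLieGroup G →
        letI : MeasurableSpace G := borel G
        haveI : BorelSpace G := ⟨rfl⟩
        ∀ r : LatticeRep G, ∀ (β₁ : ℝ) (m : ℝ → ℝ),
          (∀ β : ℝ, β₁ ≤ β → 0 < m β ∧ (∃ S₀ : ℕ, ∀ A B : YMSpecies G, ∃ C : ℝ, ∀ S n : ℕ,
              S₀ ≤ S → n ≤ S →
                |latticeConnectedCorr r.ρ β (2 * S + 1) A.F B.F n| ≤ C * Real.exp (-(m β * n)))) →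
            ∀ m₀ : ℝ, 0 < m₀ → ∀ᶠ β : ℝ in Filter.atTop, m β < m₀ := by
  intro G _ _ _ _ hG r
  exact rpProbeCriticality_proof G hG r
    (EquipartitionPinsProbe_proof G hG r (freeEnergyLogCoefficient_proof G hG r))

/-- **The hub split of `LatticeGapToClay`** (crux-strategist decomposition, BC2 redirect): weak-coupling
criticality (piece 1, stated verbatim as a closed proposition) and the hub
`EquipartitionCriticality.CriticalContinuumLimit` (piece 2, item stmt-QuantumFields-15940) imply
`RandomConstraintAnnealing.LatticeGapToClay`.  Pure logic: for each compact simple `G` the body of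
`TubeGapLatticeLeg` is hypothesis (1) of the hub up to regrouping two binders, and piece 1 is
hypothesis (2). [folklore] -/
theorem latticeGapToClay_of_subs
    (hcrit : ∀ (G : Type) [Group G] [TopologicalSpace G] [IsTopologicalGroup G] [CompactSpace G],
      IsCompactSimpleLieGroup G →
        letI : MeasurableSpace G := borel G
        haveI : BorelSpace G := ⟨rfl⟩
        ∀ r : LatticeRep G, ∀ (β₁ : ℝ) (m : ℝ → ℝ),
          (∀ β : ℝ, β₁ ≤ β → 0 < m β ∧ (∃ S₀ : ℕ, ∀ A B : YMSpecies G, ∃ C : ℝ, ∀ S n : ℕ,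
              S₀ ≤ S → n ≤ S →
                |latticeConnectedCorr r.ρ β (2 * S + 1) A.F B.F n| ≤ C * Real.exp (-(m β * n)))) →
            ∀ m₀ : ℝ, 0 < m₀ → ∀ᶠ β : ℝ in Filter.atTop, m β < m₀)
    (hhub : EquipartitionCriticality.CriticalContinuumLimit) :
    RandomConstraintAnnealing.LatticeGapToClay := by
  intro hX G _ _ _ _ hG
  refine hhub G hG (fun r => ?_) (hcrit G hG)
  obtain ⟨β₀, m, S₀, hm, hAB⟩ := hX G hG r
  refine ⟨β₀, m, S₀, hm, fun A B => ?_⟩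
  obtain ⟨C, hC⟩ := hAB A B
  exact ⟨C, fun β hβ S n hS hn => hC β hβ S hS n hn⟩

/-- **Corollary: the hub alone implies the crux** — `CriticalContinuumLimit → LatticeGapToClay`,
criticality being the tree theorem `weakCouplingCriticality`.  (Recorded for the re-audit: this is the
Wiles/Ribet shape of the split — the open piece is the shared hub stmt-QuantumFields-15940, the proved
piece is Chatterjee's Problem 5.1(b).) [folklore] -/
theorem latticeGapToClay_of_hub (hhub : EquipartitionCriticality.CriticalContinuumLimit) :
    RandomConstraintAnnealing.LatticeGapToClay :=
  latticeGapToClay_of_subs weakCouplingCriticality hhub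

/-- The converse bookkeeping used by the re-audit: `TubeGapLatticeLeg` is, clause by clause, the
hypothesis (1) of the hub for every `G` — equivalently `EquipartitionCriticality.LatticeGapLargeBeta`
(shared-crux evidence of grounder g15-10 on stmt-QuantumFields-8715/8761, re-proved). [folklore] -/
theorem latticeGapLargeBeta_iff_tubeGapLatticeLeg :
    EquipartitionCriticality.LatticeGapLargeBeta ↔ RandomConstraintAnnealing.TubeGapLatticeLeg := by
  constructor
  · intro h G _ _ _ _ hG r
    obtain ⟨β₁, m, S₀, hm, hAB⟩ := h G hG r
    refine ⟨β₁, m, S₀, hm, fun A B => ?_⟩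
    obtain ⟨C, hC⟩ := hAB A B
    exact ⟨C, fun β hβ S hS n hn => hC β hβ S n hS hn⟩
  · intro h G _ _ _ _ hG r
    obtain ⟨β₀, m, S₀, hm, hAB⟩ := h G hG r
    refine ⟨β₀, m, S₀, hm, fun A B => ?_⟩
    obtain ⟨C, hC⟩ := hAB A B
    exact ⟨C, fun β hβ S n hS hn => hC β hβ S hS n hn⟩

/-- With criticality in the tree, the summit conjunct follows from this route's lattice target and the
hub alone: `TubeGapLatticeLeg → CriticalContinuumLimit → YangMills`. [folklore] -/
theorem yangMills_of_tubeGap_of_hub (hX : RandomConstraintAnnealing.TubeGapLatticeLeg)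
    (hhub : EquipartitionCriticality.CriticalContinuumLimit) : YangMills :=
  latticeGapToClay_of_hub hhub hX

end Summit.QuantumFields.YangMills.Theorems

end
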